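import Mathlib
import Summits.NavierStokesRegularity.NavierStokesRegularity.Theorems.SubOnsagerCeilingKPSideBranchClassDynamics
import Summits.NavierStokesRegularity.NavierStokesRegularity.Theorems.SubOnsagerCeilingKPFluxBudget
import HarnessLib

/-!
# STARVED NETWORKS WITH A SHARED DEAD-END POCKET — mechanism file (energy starvation, class-wide form; part 1 of 2)
# (helper file for the crux `SubOnsagerCeiling.ForwardTailCeilingKP`, stmt-NavierStokesRegularity-27057, `--supports`)

THE SHARED-POCKET CLASS (def-free, by coefficient hypotheses on a KP network proper `α ∈ E₂(R)`: symmetric, cancelling, orthant,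
diagonal feeds): the live modes `0, 1, 2` carry an ARBITRARY diagonal forward network among themselves (weights
`w_{ae} = α a a e (0,0,1) ≥ 0`; chains, re-entry pairs, 3-cycles, fans AND merging all allowed), every live mode pumps in-shell into
the COMMON dead-end pocket `3` (weights `P a ≥ 0`, `P 3 = 0`), and nothing else happens in-shell; the pocket neither feeds nor is fed
forward.  Strength hypotheses: `ρ·w_{ae} ≤ P a` for all `a, e` and `κ·Σ_e w_{ae} ≤ P a` for all `a` (`ρ, κ ≥ 0`).  This is the
class-wide form of the energy-starvation corners `…KPDeadEndPump*`, `…KPPairExit*` (one live chain / one live pair): the pocket only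
ACCUMULATES, so it dominates every live amplitude one shell up, merging included.

* `sharedPocket_coeff`, `sharedPocket_inShell` — the in-shell coefficient table and quadratic forms
  (`Σ_{a,b} α a b i (0,0,0) y_a y_b = [i = 3]·Σ_a P a y_a² − [i ≠ 3]·P i y_i y_3`);
* `sharedPocket_quadTerm_pocket`, `sharedPocket_quadTerm_live` — closed forms (`quadTerm₃(n) = Λₙ Σ_a P a x²_{a,n}`; for `e ≠ 3`,
  `quadTerm_e(n) = Λ_{n-1}Σ_a w_{ae}x²_{a,n-1} − Λₙ x_{e,n}Σ_j w_{ej}x_{j,n+1} − Λₙ P e x_{e,n}x_{3,n}`);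
* `sharedPocket_pocket_ge` — `ρ·x_{e,N+1} ≤ x_{3,N}` on `[0,s]` for every live `e` and every shell `N ≥ 1` (one-sided Grönwall on
  `e^{ν_N t}(x_{3,N} − ρ x_{e,N+1})`, using `ρ w_{ae} ≤ P a` termwise).

The sequel `Theorems/SubOnsagerCeilingKPSharedPocketBarrier.lean`: the gate fluxes starve, `(1 + ρκ)·OUT_{n} ≤ OUT_{n-1}`, and
`ShellBarrierAt R ε₀ α` with `(1+ε₀)^{2θ} = 1 + ρκ`, `D = 1 + ρκ`, at EVERY scale ratio when `ρκ > ε₀`.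
HONEST FRAMING: statements about Tao-type MODEL lattice ODEs (route SubOnsagerCeiling, rung TL-M2Break); one architecture class; no stub,
crux or summit is proved and nothing here bears on Navier–Stokes regularity. [cite: Tao2016AveragedNS, §4 (4.2)–(4.3), (4.8), (4.13)]
[cite: Teschl2012, §2.4 (Grönwall)]
-/

noncomputable section

-- the sub-problem namespace `NavierStokesRegularity.NavierStokesRegularity` is the tree's layout (D-0017)
set_option linter.dupNamespace false

namespace Summit.NavierStokesRegularity.NavierStokesRegularity.Theorems

open Set Finset MeasureTheory intervalIntegral
open scoped Topology
open Literature.Analysis.FluidPDE.TaoCascade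

section SharedPocket

variable {α : Fin 4 → Fin 4 → Fin 4 → ℤ × ℤ × ℤ → ℝ} {P : Fin 4 → ℝ}
  (hs : IsSymmetricCoeff α) (hc : IsCancellingCoeff α)
  (hO : ∀ (Y : Fin 4 → ℤ → ℝ → ℝ) (τ : ℝ), (∀ (j : Fin 4) (k : ℤ), 1 ≤ k → 0 ≤ Y j k τ) →
    ∀ δ : ℝ, 0 < δ → ∀ (i : Fin 4) (n : ℤ), 1 ≤ n → Y i n τ = 0 → 0 ≤ quadTerm δ α Y i n τ)
  (hD : ∀ a b i : Fin 4, a ≠ b → α a b i (0, 0, 1) = 0)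
  (hw3 : ∀ a : Fin 4, α a a 3 (0, 0, 1) = 0) (h3w : ∀ e : Fin 4, α 3 3 e (0, 0, 1) = 0)
  (hPump : ∀ a d : Fin 4, a ≠ d → α a a d (0, 0, 0) = if d = 3 then P a else 0) (hP33 : P 3 = 0)
  (hCz : ∀ a b d : Fin 4, a ≠ b → a ≠ d → b ≠ d → α a b d (0, 0, 0) = 0)
include hs hc hO hD hw3 h3w hPump hP33 hCz

omit hO hD hw3 h3w hP33 in
/-- The in-shell coefficient table of the shared-pocket class: pumps `P a` at `(a,a,3)`, back-reactions `−P a/2` at `(a,3,a)`,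
`(3,a,a)`, nothing else (`P 3 = 0`). [this file] -/
theorem sharedPocket_coeff (a b i : Fin 4) :
    α a b i (0, 0, 0) = (if a = b ∧ i = 3 then P a else 0) +
      (if b = 3 ∧ i = a then -(P a) / 2 else 0) + (if a = 3 ∧ i = b then -(P b) / 2 else 0) := by
  have hdiag : ∀ e : Fin 4, α e e e (0, 0, 0) = 0 := fun e => kpProper_inShell_diag_zero hc e
  have hback : ∀ e j : Fin 4, e ≠ j → α e j e (0, 0, 0) = -(α e e j (0, 0, 0)) / 2 := by
    intro e j hej
    have h1 := kpProper_inShell_back hc e j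
    have h2 : α j e e (0, 0, 0) = α e j e (0, 0, 0) := hs j e e 0 0 0 kpProper_mem000
    linarith
  have hback' : ∀ e j : Fin 4, e ≠ j → α j e e (0, 0, 0) = -(α e e j (0, 0, 0)) / 2 := by
    intro e j hej
    rw [hs j e e 0 0 0 kpProper_mem000, hback e j hej]
  fin_cases a <;> fin_cases b <;> fin_cases i <;>
    first
      | (rw [hdiag]; simp; ring)
      | (rw [hdiag]; simp)
      | (rw [hCz _ _ _ (by decide) (by decide) (by decide)]; simp)
      | (rw [hPump _ _ (by decide)]; simp)
      | (rw [hback _ _ (by decide), hPump _ _ (by decide)]; simp)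
      | (rw [hback' _ _ (by decide), hPump _ _ (by decide)]; simp)

omit hO hD hw3 h3w in
/-- The in-shell quadratic forms: `Σ_a P a y_a²` into the pocket, `−P i y_i y_3` on a live mode. [this file] -/
theorem sharedPocket_inShell (y : Fin 4 → ℝ) (i : Fin 4) :
    ∑ a, ∑ b, α a b i (0, 0, 0) * (y a * y b) =
      (if i = 3 then ∑ a, P a * y a ^ 2 else 0) + (if i = 3 then 0 else -(P i * (y i * y 3))) := by
  simp only [sharedPocket_coeff hs hc hPump hCz, Fin.sum_univ_four]
  fin_cases i
  · simp
    ring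
  · simp
    ring
  · simp
    ring
  · simp [hP33]
    ring

omit hs hc hO hD h3w hPump hP33 hCz in
/-- Nothing feeds the pocket forward: `Σ_a α a a 3 (0,0,1)·y_a² = 0`. [this file] -/
theorem sharedPocket_feed_pocket (y : Fin 4 → ℝ) : ∑ a, α a a 3 (0, 0, 1) * y a ^ 2 = 0 := by
  simp [hw3]

omit hs hc hO hD hw3 hPump hP33 hCz in
/-- The pocket feeds nothing: `Σ_j α 3 3 j (0,0,1)·z_j = 0`. [this file] -/
theorem sharedPocket_drain_pocket (z : Fin 4 → ℝ) : ∑ j, α 3 3 j (0, 0, 1) * z j = 0 := by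
  simp [h3w]

/-- **The pocket**: `quadTerm₃(n) = Λₙ Σ_a P a x²_{a,n}`. [this file] -/
theorem sharedPocket_quadTerm_pocket (ε₀ : ℝ) (X : Fin 4 → ℤ → ℝ → ℝ) (n : ℤ) (t : ℝ) :
    quadTerm ε₀ α X 3 n t = (1 + ε₀) ^ ((5 : ℝ) * n / 2) * ∑ a, P a * X a n t ^ 2 := by
  rw [kpProper_quadTerm hs hc hO hD, sharedPocket_feed_pocket hw3 (fun a => X a (n - 1) t),
    sharedPocket_drain_pocket h3w (fun j => X j (n + 1) t), sharedPocket_inShell hs hc hPump hP33 hCz (fun j => X j n t) 3]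
  simp

omit hw3 h3w in
/-- **A live mode** `e ≠ 3`: `quadTerm_e(n) = Λ_{n-1}Σ_a w_{ae}x²_{a,n-1} − Λₙ x_{e,n}Σ_j w_{ej}x_{j,n+1} − Λₙ P e x_{e,n}x_{3,n}`. [this file] -/
theorem sharedPocket_quadTerm_live (ε₀ : ℝ) (X : Fin 4 → ℤ → ℝ → ℝ) {e : Fin 4} (he : e ≠ 3) (n : ℤ) (t : ℝ) :
    quadTerm ε₀ α X e n t =
      (1 + ε₀) ^ ((5 : ℝ) * ((n : ℝ) - 1) / 2) * ∑ a, α a a e (0, 0, 1) * X a (n - 1) t ^ 2 -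
        (1 + ε₀) ^ ((5 : ℝ) * n / 2) * (X e n t * ∑ j, α e e j (0, 0, 1) * X j (n + 1) t) -
        (1 + ε₀) ^ ((5 : ℝ) * n / 2) * (P e * (X e n t * X 3 n t)) := by
  rw [kpProper_quadTerm hs hc hO hD, sharedPocket_inShell hs hc hPump hP33 hCz (fun j => X j n t) e]
  simp [he]
  ring

/-- **The shared pocket dominates every live amplitude one shell up**: along an honest non-negative `ν`-viscous solution from a
one-shell datum (`ν ≥ 0`, `ε₀ ≥ 0`, `P ≥ 0`, `ρ ≥ 0`, `ρ·w_{ae} ≤ P a` for all `a, e`), for every live `e ≠ 3`, every shell `N ≥ 1`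
and `t ∈ [0,s]`: `ρ·x_{e,N+1}(t) ≤ x_{3,N}(t)`. [cite: Teschl2012, §2.4 (Grönwall)] -/
theorem sharedPocket_pocket_ge {ε₀ ν s ρ : ℝ} (hε : 0 ≤ ε₀) (hν : 0 ≤ ν) (hρ0 : 0 ≤ ρ) (hPnn : ∀ a, 0 ≤ P a)
    (hρ : ∀ a e : Fin 4, ρ * α a a e (0, 0, 1) ≤ P a)
    {X₀ : Fin 4 → ℝ} {X : Fin 4 → ℤ → ℝ → ℝ}
    (hdat : ∀ (i : Fin 4) (k : ℤ), X i k 0 = if k = 0 then X₀ i else 0)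
    (hode : ∀ (i : Fin 4) (k : ℤ), ∀ t ∈ Icc (0 : ℝ) s, HasDerivWithinAt (X i k)
      (quadTerm ε₀ α X i k t - ν * (1 + ε₀) ^ ((2 : ℝ) * k) * X i k t) (Icc (0 : ℝ) s) t)
    (hnn : ∀ t ∈ Icc (0 : ℝ) s, ∀ (i : Fin 4) (k : ℤ), 1 ≤ k → 0 ≤ X i k t)
    {e : Fin 4} (he : e ≠ 3) {N : ℤ} (hN : 1 ≤ N) :
    ∀ t ∈ Icc (0 : ℝ) s, ρ * X e (N + 1) t ≤ X 3 N t := by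
  have hw0 : ∀ a i : Fin 4, 0 ≤ α a a i (0, 0, 1) := fun a i => kpProper_feed_nonneg hO a i
  set κ : ℝ := ν * (1 + ε₀) ^ ((2 : ℝ) * N) with hκ
  set κ' : ℝ := ν * (1 + ε₀) ^ ((2 : ℝ) * ((N + 1 : ℤ) : ℝ)) with hκ'
  have hb1 : (1 : ℝ) ≤ 1 + ε₀ := by linarith
  have hκκ' : κ ≤ κ' := by
    simp only [hκ, hκ']
    refine mul_le_mul_of_nonneg_left (Real.rpow_le_rpow_of_exponent_le hb1 ?_) hν
    push_cast
    linarith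
  -- drains of `e` at shell `N+1`
  set Dr : ℝ → ℝ := fun τ => ∑ j, α e e j (0, 0, 1) * X j (N + 1 + 1) τ with hDr
  have hDrnn : ∀ τ ∈ Icc (0 : ℝ) s, 0 ≤ Dr τ := fun τ hτ =>
    Finset.sum_nonneg fun j _ => mul_nonneg (hw0 e j) (hnn τ hτ j _ (by omega))
  set u : ℝ → ℝ := fun τ => X 3 N τ - ρ * X e (N + 1) τ with hu
  set u' : ℝ → ℝ := fun τ =>
    ((1 + ε₀) ^ ((5 : ℝ) * N / 2) * (∑ a, P a * X a N τ ^ 2) - κ * X 3 N τ) -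
      ρ * ((1 + ε₀) ^ ((5 : ℝ) * ((((N + 1 : ℤ)) : ℝ) - 1) / 2) * (∑ a, α a a e (0, 0, 1) * X a (N + 1 - 1) τ ^ 2) -
        (1 + ε₀) ^ ((5 : ℝ) * ((N + 1 : ℤ) : ℝ) / 2) * (X e (N + 1) τ * Dr τ) -
        (1 + ε₀) ^ ((5 : ℝ) * ((N + 1 : ℤ) : ℝ) / 2) * (P e * (X e (N + 1) τ * X 3 (N + 1) τ)) -
        κ' * X e (N + 1) τ) with hu'
  have hud : ∀ τ ∈ Icc (0 : ℝ) s, HasDerivWithinAt u (u' τ) (Icc 0 s) τ := by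
    intro τ hτ
    have h1 := hode 3 N τ hτ
    rw [sharedPocket_quadTerm_pocket hs hc hO hD hw3 h3w hPump hP33 hCz] at h1
    have h0 := hode e (N + 1) τ hτ
    rw [sharedPocket_quadTerm_live hs hc hO hD hPump hP33 hCz ε₀ X he] at h0
    exact h1.sub (h0.const_mul ρ)
  have hkey : ∀ τ ∈ Icc (0 : ℝ) s, 0 ≤ u' τ + κ * u τ := by
    intro τ hτ
    have hx : 0 ≤ X e (N + 1) τ := hnn τ hτ e _ (by omega)
    have hx3 : 0 ≤ X 3 (N + 1) τ := hnn τ hτ 3 _ (by omega)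
    have hΛ : 0 ≤ (1 + ε₀) ^ ((5 : ℝ) * N / 2) := Real.rpow_nonneg (by linarith) _
    have hΛ' : 0 ≤ (1 + ε₀) ^ ((5 : ℝ) * ((N + 1 : ℤ) : ℝ) / 2) := Real.rpow_nonneg (by linarith) _
    -- the drive of the pocket dominates `ρ ×` the feed into `e`
    have hdrive : ρ * ∑ a, α a a e (0, 0, 1) * X a N τ ^ 2 ≤ ∑ a, P a * X a N τ ^ 2 := by
      rw [Finset.mul_sum]
      refine Finset.sum_le_sum fun a _ => ?_
      have := mul_le_mul_of_nonneg_right (hρ a e) (sq_nonneg (X a N τ))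
      linarith [this]
    have hsimp : u' τ + κ * u τ =
        (1 + ε₀) ^ ((5 : ℝ) * N / 2) * (∑ a, P a * X a N τ ^ 2 - ρ * ∑ a, α a a e (0, 0, 1) * X a N τ ^ 2) +
          ρ * ((1 + ε₀) ^ ((5 : ℝ) * ((N + 1 : ℤ) : ℝ) / 2) * (X e (N + 1) τ * Dr τ)) +
          ρ * ((1 + ε₀) ^ ((5 : ℝ) * ((N + 1 : ℤ) : ℝ) / 2) * (P e * (X e (N + 1) τ * X 3 (N + 1) τ))) +
          ρ * (κ' - κ) * X e (N + 1) τ := by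
      have hidx : (N + 1 - 1 : ℤ) = N := by omega
      have hexp : ((5 : ℝ) * ((((N + 1 : ℤ)) : ℝ) - 1) / 2) = (5 : ℝ) * N / 2 := by push_cast; ring
      simp only [hu, hu', hidx, hexp]
      ring
    rw [hsimp]
    have h1 : 0 ≤ (1 + ε₀) ^ ((5 : ℝ) * N / 2) *
        (∑ a, P a * X a N τ ^ 2 - ρ * ∑ a, α a a e (0, 0, 1) * X a N τ ^ 2) := mul_nonneg hΛ (by linarith)
    have h2 : 0 ≤ ρ * ((1 + ε₀) ^ ((5 : ℝ) * ((N + 1 : ℤ) : ℝ) / 2) * (X e (N + 1) τ * Dr τ)) :=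
      mul_nonneg hρ0 (mul_nonneg hΛ' (mul_nonneg hx (hDrnn τ hτ)))
    have h3 : 0 ≤ ρ * ((1 + ε₀) ^ ((5 : ℝ) * ((N + 1 : ℤ) : ℝ) / 2) * (P e * (X e (N + 1) τ * X 3 (N + 1) τ))) :=
      mul_nonneg hρ0 (mul_nonneg hΛ' (mul_nonneg (hPnn e) (mul_nonneg hx hx3)))
    have h4 : 0 ≤ ρ * (κ' - κ) * X e (N + 1) τ := mul_nonneg (mul_nonneg hρ0 (by linarith)) hx
    linarith
  set G : ℝ → ℝ := fun τ => Real.exp (κ * τ) * u τ with hG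
  set G' : ℝ → ℝ := fun τ => Real.exp (κ * τ) * (u' τ + κ * u τ) with hG'
  have hGd : ∀ τ ∈ Icc (0 : ℝ) s, HasDerivWithinAt G (G' τ) (Icc 0 s) τ := by
    intro τ hτ
    have hexp : HasDerivWithinAt (fun θ => Real.exp (κ * θ)) (Real.exp (κ * τ) * κ) (Icc 0 s) τ := by
      have := ((hasDerivAt_id τ).const_mul κ).exp
      simpa using this.hasDerivWithinAt
    have h := hexp.mul (hud τ hτ)
    refine h.congr_deriv ?_
    simp only [hG']
    ring
  have hGmono : MonotoneOn G (Icc 0 s) := by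
    have hGcont : ContinuousOn G (Icc 0 s) := fun τ hτ => (hGd τ hτ).continuousWithinAt
    refine monotoneOn_of_hasDerivWithinAt_nonneg (f' := G') (convex_Icc 0 s) hGcont ?_ ?_
    · intro x hx
      rw [interior_Icc] at hx ⊢
      exact (hGd x (Ioo_subset_Icc_self hx)).mono Ioo_subset_Icc_self
    · intro x hx
      rw [interior_Icc] at hx
      exact mul_nonneg (Real.exp_pos _).le (hkey x (Ioo_subset_Icc_self hx))
  have hG0 : G 0 = 0 := by
    have h1 : X 3 N 0 = 0 := by rw [hdat]; simp; omega
    have h2 : X e (N + 1) 0 = 0 := by rw [hdat]; simp; omega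
    simp [hG, hu, h1, h2]
  intro t ht
  have hGt : 0 ≤ G t := by
    rw [← hG0]
    exact hGmono ⟨le_rfl, ht.1.trans ht.2⟩ ht ht.1
  have hexp : 0 < Real.exp (κ * t) := Real.exp_pos _
  have hut : 0 ≤ u t := by
    by_contra hh
    push Not at hh
    have : G t < 0 := by simp only [hG]; nlinarith [mul_pos hexp (neg_pos.2 hh)]
    linarith
  simp only [hu] at hut
  linarith

end SharedPocket

end Summit.NavierStokesRegularity.NavierStokesRegularity.Theorems

end
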